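import Summits.ABC.IUTFork.Conditional.InhUniformBandCells
import HarnessLib

/-!
# R-W WINDOW-TABLE, W3 «UNIFORM LEMMA» lane, INHABITED side — the integer cells of `1 + 3¹⁶·7 = 2³·11·23·53³` for EVERY level `l`
# (row «W:INHABITED-BANDS», abc-iut-plan g10 C-R72; certificate recipe abc-iut-rw-num-lead INHABITED-UNIFORM-CERTS.tsv 572449ea63f1d45c)

PROOF-ONLY file (D-0012; 0 definitions, 0 `Prop` facts; pure integer arithmetic) of the abc-iut cell — D-0079 RESCUE sub-cell R-W
«WINDOW Θ-SIDE INEQUALITY», seat abc-iut-W-num-6 (gen 3). For the known abc triple `1 + 3¹⁶·7 = 2³·11·23·53³` (`λ = 1/301327048`) and each odd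
prime `p ∣ abc`: the licence socket's integer cell `e·⌊(j²P − j·D − (j+1)·ρin)/e⌋ + (j+1)·ρout ≤ P` (abc-iut-w4-d036 p460046/p460573,
orders form `Cor312Prov.licence_settingPrVolSharp_pilotDataOfK_of_orders_rat` of abc-iut-W-row-1; `P = e·2v_p(abc)/(2l)`) at EVERY label
`j ≤ (l−1)/2`, for EVERY level `l ≥ L₀(p)` and EVERY ramification index of the kernel's divisibility class `e = E₀(p)·l·m`, `m ≥ 1`
(`l ∣ e` abc-iut-W-neg-1 `GenuineK.prime_dvd_absRamificationIdx_kOf_ratPoint`; `15·l ∣ e·v_p` Tate root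
`GenuineK.fifteen_mul_prime_dvd_absRamificationIdx_kOf_mul_ratPoint`; `(p−1) ∣ e` at `p ∣ 30` abc-iut-W-neg-2
`GenuineK.sub_one_dvd_absRamificationIdx_kOf`; `2·l ∣ e`, `30·l ∣ e·v_p` at an ODD pole of `λ` abc-iut-w4-d107
`GenuineK.thirty_mul_prime_dvd_absRamificationIdx_kOf_mul_of_odd_pole`), with the ONE-SIDED data the kernel supplies for every such field:
`D = 2e − 1` at `p ∈ {{3,5}}`, `p ∤ v_p` (abc-iut-W-neg-1 `GenuineK.sub_one_div_le_differentOrd_kOf_wild_ratPoint`) else `D = e − 1`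
([IUTchIV] Prop. 1.3 (i)); `ρin = ⌊e/(p−1)⌋` (abc-iut-c312-5's integer slot, `WRow.inner_witness_slot`) or `1`; `ρout = min(p^a − a·e, p^b − b·e)`
(abc-iut-c312-3's envelope, `WRow.outer_member_min`). METHOD (uniform in `l`, no case split on `l`): drop the floor (`InhBand.cell_of_noFloor` shape),
the floor-free form is a CONVEX quadratic in `j` so its two ends suffice (`InhBand.quad_nonpos_of_ends`), and each end is linear in `m` with
coefficients polynomial (degree ≤ 2) in `l`, nonpositive from `L₀` on (`InhBand.quad_nonpos_from`). Thresholds and coefficients: this seat's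
second engine HOME/abc-iut-W-num-6/inhband/engine.py + emit_cells.py (exact integers; cross-checked against the EXACT cell for `l ≤ 300`,
`m ≤ 3`). Per prime: `p = 7`: `E₀ = 15`, `L₀ = 5`, `a = 0`; `p = 11`: `E₀ = 15`, `L₀ = 5`, `a = 0`; `p = 23`: `E₀ = 15`, `L₀ = 5`, `a = 0`; `p = 53`: `E₀ = 5`, `L₀ = 16`, `a = 1`. Consumer: `InhUniformBandFrey1.lean` (the datum theorem «S_H INHABITED at EVERY genuine Θ-volume datum over
`(ratPoint λ, l)` for EVERY prime `l ≥ 16`»). HONEST SCOPE: integer arithmetic only; nothing here bears on the printed inequality of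
[IUTchIII] Cor. 3.12; inhabited-as-typed ≠ true-in-print; no abc claim. [folklore]
-/

namespace Summit.ABC.IUTFork.Conditional

/-! ## Over `7` (`v_7(abc) = 1`, `E₀ = 15`, `L₀ = 5`) -/

/-- Floor-free form of the cell over `7` for `frey1` (`e = 15·l·m`, `P = 15·m`, `D = e − 1`, `ρin = 1`, `ρout ≤ 7^0 − 0·e`): nonpositive at every label `1 ≤ k+1 ≤ (l−1)/2` for every `l ≥ 5`, `m ≥ 1` — convex in the label, both ends polynomial in `l` and linear in `m`. [folklore] -/
theorem InhBand.poly_frey1_p7 (k l m : ℤ) (hl : 5 ≤ l) (hm : 1 ≤ m) (hk : 0 ≤ k) (hkl : 2 * (k + 1) + 1 ≤ l) :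
    (k + 1) ^ 2 * (15 * m) - (k + 1) * (1 * (15 * l * m) - 1) - (k + 2) * 1 + (k + 2) * ((7 : ℤ) ^ 0 - 0 * (15 * l * m)) ≤ (15 * m) := by
  have hα1 : (-15) * l + (0) ≤ 0 := by linarith
  have hs1 : (-15) * l + (1) ≤ 0 := by linarith
  have hαM : (-15) * l ^ 2 + (0) * l + (-45) ≤ 0 :=
    InhBand.quad_nonpos_from (-15) (0) (-45) 5 l hl (by norm_num) (by norm_num) (by norm_num)
  have hsM : (-15) * l ^ 2 + (2) * l + (-47) ≤ 0 :=
    InhBand.quad_nonpos_from (-15) (2) (-47) 5 l hl (by norm_num) (by norm_num) (by norm_num)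
  have hm0 : 0 ≤ m - 1 := by linarith
  have h1 : (15 * m) + (((7 : ℤ) ^ 0 - 0 * (15 * l * m)) - (1 * (15 * l * m) - 1) - 1) + (((7 : ℤ) ^ 0 - 0 * (15 * l * m)) - 1 - (15 * m)) ≤ 0 := by
    have hid : (15 * m) + (((7 : ℤ) ^ 0 - 0 * (15 * l * m)) - (1 * (15 * l * m) - 1) - 1) + (((7 : ℤ) ^ 0 - 0 * (15 * l * m)) - 1 - (15 * m)) = m * ((-15) * l + (0)) + ((0) * l + (1)) := by ring
    rw [hid]; nlinarith [mul_nonpos_iff.mpr (Or.inl ⟨hm0, hα1⟩)]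
  have hM : (15 * m) * (l - 1) ^ 2 + 2 * (((7 : ℤ) ^ 0 - 0 * (15 * l * m)) - (1 * (15 * l * m) - 1) - 1) * (l - 1) + 4 * (((7 : ℤ) ^ 0 - 0 * (15 * l * m)) - 1 - (15 * m)) ≤ 0 := by
    have hid : (15 * m) * (l - 1) ^ 2 + 2 * (((7 : ℤ) ^ 0 - 0 * (15 * l * m)) - (1 * (15 * l * m) - 1) - 1) * (l - 1) + 4 * (((7 : ℤ) ^ 0 - 0 * (15 * l * m)) - 1 - (15 * m)) =
        m * ((-15) * l ^ 2 + (0) * l + (-45)) + ((0) * l ^ 2 + (2) * l + (-2)) := by ring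
    rw [hid]; nlinarith [mul_nonpos_iff.mpr (Or.inl ⟨hm0, hαM⟩)]
  have hA : 0 ≤ (15 * m) := by positivity
  have h := InhBand.quad_nonpos_of_ends (15 * m) (((7 : ℤ) ^ 0 - 0 * (15 * l * m)) - (1 * (15 * l * m) - 1) - 1) (((7 : ℤ) ^ 0 - 0 * (15 * l * m)) - 1 - (15 * m)) (k + 1) l hA (by linarith) (by linarith) hkl h1 hM
  linarith [h]

/-- **Cells over `7` for `frey1`, EVERY level `l ≥ 5`, every `e = 15·l·m` (`m ≥ 1`), every label `j = k + 1 ≤ (l−1)/2`**: the socket's integer cell `e·⌊(j²P − j·D − (j+1)·ρin)/e⌋ + (j+1)·ρout ≤ P` with `P = e·2/(2l) = 15·m`, `D = e − 1`, `ρin = 1`, `ρout = min(7^0 − 0e, 7^1 − 1e)` (floor dropped, then `InhBand.poly_frey1_p7`). [folklore] -/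
theorem InhBand.cell_frey1_p7 {l m : ℕ} (hl : 5 ≤ l) (hm : 1 ≤ m) (k : ℕ) (hk : k < (l - 1) / 2) :
    ((15 * l * m : ℕ) : ℤ) *
          (((((k + 1 : ℕ) : ℤ) ^ 2 * ((15 * l * m * 2 / (2 * l) : ℕ) : ℤ) - ((k + 1 : ℕ) : ℤ) * ((15 * l * m - 1 : ℕ) : ℤ) -
              ((k + 2 : ℕ) : ℤ) * (1 : ℤ))) / ((15 * l * m : ℕ) : ℤ)) +
        ((k + 2 : ℕ) : ℤ) * min ((7 : ℤ) ^ 0 - 0 * ((15 * l * m : ℕ) : ℤ)) ((7 : ℤ) ^ 1 - 1 * ((15 * l * m : ℕ) : ℤ)) ≤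
      ((15 * l * m * 2 / (2 * l) : ℕ) : ℤ) := by
  have hP : (15 * l * m * 2 / (2 * l) : ℕ) = 15 * m := by
    rw [show 15 * l * m * 2 = 2 * l * (15 * m) by ring]; exact Nat.mul_div_cancel_left _ (by omega)
  have he0 : (0 : ℤ) < ((15 * l * m : ℕ) : ℤ) := by positivity
  have hfloor := Int.mul_ediv_self_le (k := ((15 * l * m : ℕ) : ℤ))
    (x := (((k + 1 : ℕ) : ℤ) ^ 2 * ((15 * l * m * 2 / (2 * l) : ℕ) : ℤ) - ((k + 1 : ℕ) : ℤ) * ((15 * l * m - 1 : ℕ) : ℤ) -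
              ((k + 2 : ℕ) : ℤ) * (1 : ℤ))) he0.ne'
  have hl0 : 0 < l := by omega
  have hm0 : 0 < m := by omega
  have hsub : ((15 * l * m - 1 : ℕ) : ℤ) = 1 * ((15 * l * m : ℕ) : ℤ) - 1 := by
    rw [Nat.cast_sub (Nat.succ_le_of_lt (by positivity))]; push_cast; ring
  have hmin : min ((7 : ℤ) ^ 0 - 0 * ((15 * l * m : ℕ) : ℤ)) ((7 : ℤ) ^ 1 - 1 * ((15 * l * m : ℕ) : ℤ)) ≤ (7 : ℤ) ^ 0 - 0 * ((15 * l * m : ℕ) : ℤ) := min_le_left _ _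
  have hk2 : (0 : ℤ) ≤ ((k + 2 : ℕ) : ℤ) := by positivity
  have hmin' := mul_le_mul_of_nonneg_left hmin hk2
  have hkl : 2 * ((k : ℤ) + 1) + 1 ≤ (l : ℤ) := by
    have h1 : 2 * (k + 1) + 1 ≤ l := by omega
    exact_mod_cast h1
  have hpoly := InhBand.poly_frey1_p7 (k : ℤ) (l : ℤ) (m : ℤ) (by exact_mod_cast hl) (by exact_mod_cast hm) (by positivity) hkl
  generalize hQ : ((((k + 1 : ℕ) : ℤ) ^ 2 * ((15 * l * m * 2 / (2 * l) : ℕ) : ℤ) - ((k + 1 : ℕ) : ℤ) * ((15 * l * m - 1 : ℕ) : ℤ) -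
              ((k + 2 : ℕ) : ℤ) * (1 : ℤ))) / ((15 * l * m : ℕ) : ℤ) = Q at hfloor ⊢
  rw [hP, hsub] at hfloor; rw [hP]
  push_cast at hfloor hmin' hpoly ⊢
  linarith [hfloor, hmin', hpoly]

/-! ## Over `11` (`v_11(abc) = 1`, `E₀ = 15`, `L₀ = 5`) -/

/-- Floor-free form of the cell over `11` for `frey1` (`e = 15·l·m`, `P = 15·m`, `D = e − 1`, `ρin = 1`, `ρout ≤ 11^0 − 0·e`): nonpositive at every label `1 ≤ k+1 ≤ (l−1)/2` for every `l ≥ 5`, `m ≥ 1` — convex in the label, both ends polynomial in `l` and linear in `m`. [folklore] -/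
theorem InhBand.poly_frey1_p11 (k l m : ℤ) (hl : 5 ≤ l) (hm : 1 ≤ m) (hk : 0 ≤ k) (hkl : 2 * (k + 1) + 1 ≤ l) :
    (k + 1) ^ 2 * (15 * m) - (k + 1) * (1 * (15 * l * m) - 1) - (k + 2) * 1 + (k + 2) * ((11 : ℤ) ^ 0 - 0 * (15 * l * m)) ≤ (15 * m) := by
  have hα1 : (-15) * l + (0) ≤ 0 := by linarith
  have hs1 : (-15) * l + (1) ≤ 0 := by linarith
  have hαM : (-15) * l ^ 2 + (0) * l + (-45) ≤ 0 :=
    InhBand.quad_nonpos_from (-15) (0) (-45) 5 l hl (by norm_num) (by norm_num) (by norm_num)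
  have hsM : (-15) * l ^ 2 + (2) * l + (-47) ≤ 0 :=
    InhBand.quad_nonpos_from (-15) (2) (-47) 5 l hl (by norm_num) (by norm_num) (by norm_num)
  have hm0 : 0 ≤ m - 1 := by linarith
  have h1 : (15 * m) + (((11 : ℤ) ^ 0 - 0 * (15 * l * m)) - (1 * (15 * l * m) - 1) - 1) + (((11 : ℤ) ^ 0 - 0 * (15 * l * m)) - 1 - (15 * m)) ≤ 0 := by
    have hid : (15 * m) + (((11 : ℤ) ^ 0 - 0 * (15 * l * m)) - (1 * (15 * l * m) - 1) - 1) + (((11 : ℤ) ^ 0 - 0 * (15 * l * m)) - 1 - (15 * m)) = m * ((-15) * l + (0)) + ((0) * l + (1)) := by ring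
    rw [hid]; nlinarith [mul_nonpos_iff.mpr (Or.inl ⟨hm0, hα1⟩)]
  have hM : (15 * m) * (l - 1) ^ 2 + 2 * (((11 : ℤ) ^ 0 - 0 * (15 * l * m)) - (1 * (15 * l * m) - 1) - 1) * (l - 1) + 4 * (((11 : ℤ) ^ 0 - 0 * (15 * l * m)) - 1 - (15 * m)) ≤ 0 := by
    have hid : (15 * m) * (l - 1) ^ 2 + 2 * (((11 : ℤ) ^ 0 - 0 * (15 * l * m)) - (1 * (15 * l * m) - 1) - 1) * (l - 1) + 4 * (((11 : ℤ) ^ 0 - 0 * (15 * l * m)) - 1 - (15 * m)) =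
        m * ((-15) * l ^ 2 + (0) * l + (-45)) + ((0) * l ^ 2 + (2) * l + (-2)) := by ring
    rw [hid]; nlinarith [mul_nonpos_iff.mpr (Or.inl ⟨hm0, hαM⟩)]
  have hA : 0 ≤ (15 * m) := by positivity
  have h := InhBand.quad_nonpos_of_ends (15 * m) (((11 : ℤ) ^ 0 - 0 * (15 * l * m)) - (1 * (15 * l * m) - 1) - 1) (((11 : ℤ) ^ 0 - 0 * (15 * l * m)) - 1 - (15 * m)) (k + 1) l hA (by linarith) (by linarith) hkl h1 hM
  linarith [h]

/-- **Cells over `11` for `frey1`, EVERY level `l ≥ 5`, every `e = 15·l·m` (`m ≥ 1`), every label `j = k + 1 ≤ (l−1)/2`**: the socket's integer cell `e·⌊(j²P − j·D − (j+1)·ρin)/e⌋ + (j+1)·ρout ≤ P` with `P = e·2/(2l) = 15·m`, `D = e − 1`, `ρin = 1`, `ρout = min(11^0 − 0e, 11^1 − 1e)` (floor dropped, then `InhBand.poly_frey1_p11`). [folklore] -/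
theorem InhBand.cell_frey1_p11 {l m : ℕ} (hl : 5 ≤ l) (hm : 1 ≤ m) (k : ℕ) (hk : k < (l - 1) / 2) :
    ((15 * l * m : ℕ) : ℤ) *
          (((((k + 1 : ℕ) : ℤ) ^ 2 * ((15 * l * m * 2 / (2 * l) : ℕ) : ℤ) - ((k + 1 : ℕ) : ℤ) * ((15 * l * m - 1 : ℕ) : ℤ) -
              ((k + 2 : ℕ) : ℤ) * (1 : ℤ))) / ((15 * l * m : ℕ) : ℤ)) +
        ((k + 2 : ℕ) : ℤ) * min ((11 : ℤ) ^ 0 - 0 * ((15 * l * m : ℕ) : ℤ)) ((11 : ℤ) ^ 1 - 1 * ((15 * l * m : ℕ) : ℤ)) ≤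
      ((15 * l * m * 2 / (2 * l) : ℕ) : ℤ) := by
  have hP : (15 * l * m * 2 / (2 * l) : ℕ) = 15 * m := by
    rw [show 15 * l * m * 2 = 2 * l * (15 * m) by ring]; exact Nat.mul_div_cancel_left _ (by omega)
  have he0 : (0 : ℤ) < ((15 * l * m : ℕ) : ℤ) := by positivity
  have hfloor := Int.mul_ediv_self_le (k := ((15 * l * m : ℕ) : ℤ))
    (x := (((k + 1 : ℕ) : ℤ) ^ 2 * ((15 * l * m * 2 / (2 * l) : ℕ) : ℤ) - ((k + 1 : ℕ) : ℤ) * ((15 * l * m - 1 : ℕ) : ℤ) -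
              ((k + 2 : ℕ) : ℤ) * (1 : ℤ))) he0.ne'
  have hl0 : 0 < l := by omega
  have hm0 : 0 < m := by omega
  have hsub : ((15 * l * m - 1 : ℕ) : ℤ) = 1 * ((15 * l * m : ℕ) : ℤ) - 1 := by
    rw [Nat.cast_sub (Nat.succ_le_of_lt (by positivity))]; push_cast; ring
  have hmin : min ((11 : ℤ) ^ 0 - 0 * ((15 * l * m : ℕ) : ℤ)) ((11 : ℤ) ^ 1 - 1 * ((15 * l * m : ℕ) : ℤ)) ≤ (11 : ℤ) ^ 0 - 0 * ((15 * l * m : ℕ) : ℤ) := min_le_left _ _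
  have hk2 : (0 : ℤ) ≤ ((k + 2 : ℕ) : ℤ) := by positivity
  have hmin' := mul_le_mul_of_nonneg_left hmin hk2
  have hkl : 2 * ((k : ℤ) + 1) + 1 ≤ (l : ℤ) := by
    have h1 : 2 * (k + 1) + 1 ≤ l := by omega
    exact_mod_cast h1
  have hpoly := InhBand.poly_frey1_p11 (k : ℤ) (l : ℤ) (m : ℤ) (by exact_mod_cast hl) (by exact_mod_cast hm) (by positivity) hkl
  generalize hQ : ((((k + 1 : ℕ) : ℤ) ^ 2 * ((15 * l * m * 2 / (2 * l) : ℕ) : ℤ) - ((k + 1 : ℕ) : ℤ) * ((15 * l * m - 1 : ℕ) : ℤ) -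
              ((k + 2 : ℕ) : ℤ) * (1 : ℤ))) / ((15 * l * m : ℕ) : ℤ) = Q at hfloor ⊢
  rw [hP, hsub] at hfloor; rw [hP]
  push_cast at hfloor hmin' hpoly ⊢
  linarith [hfloor, hmin', hpoly]

/-! ## Over `23` (`v_23(abc) = 1`, `E₀ = 15`, `L₀ = 5`) -/

/-- Floor-free form of the cell over `23` for `frey1` (`e = 15·l·m`, `P = 15·m`, `D = e − 1`, `ρin = 1`, `ρout ≤ 23^0 − 0·e`): nonpositive at every label `1 ≤ k+1 ≤ (l−1)/2` for every `l ≥ 5`, `m ≥ 1` — convex in the label, both ends polynomial in `l` and linear in `m`. [folklore] -/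
theorem InhBand.poly_frey1_p23 (k l m : ℤ) (hl : 5 ≤ l) (hm : 1 ≤ m) (hk : 0 ≤ k) (hkl : 2 * (k + 1) + 1 ≤ l) :
    (k + 1) ^ 2 * (15 * m) - (k + 1) * (1 * (15 * l * m) - 1) - (k + 2) * 1 + (k + 2) * ((23 : ℤ) ^ 0 - 0 * (15 * l * m)) ≤ (15 * m) := by
  have hα1 : (-15) * l + (0) ≤ 0 := by linarith
  have hs1 : (-15) * l + (1) ≤ 0 := by linarith
  have hαM : (-15) * l ^ 2 + (0) * l + (-45) ≤ 0 :=
    InhBand.quad_nonpos_from (-15) (0) (-45) 5 l hl (by norm_num) (by norm_num) (by norm_num)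
  have hsM : (-15) * l ^ 2 + (2) * l + (-47) ≤ 0 :=
    InhBand.quad_nonpos_from (-15) (2) (-47) 5 l hl (by norm_num) (by norm_num) (by norm_num)
  have hm0 : 0 ≤ m - 1 := by linarith
  have h1 : (15 * m) + (((23 : ℤ) ^ 0 - 0 * (15 * l * m)) - (1 * (15 * l * m) - 1) - 1) + (((23 : ℤ) ^ 0 - 0 * (15 * l * m)) - 1 - (15 * m)) ≤ 0 := by
    have hid : (15 * m) + (((23 : ℤ) ^ 0 - 0 * (15 * l * m)) - (1 * (15 * l * m) - 1) - 1) + (((23 : ℤ) ^ 0 - 0 * (15 * l * m)) - 1 - (15 * m)) = m * ((-15) * l + (0)) + ((0) * l + (1)) := by ring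
    rw [hid]; nlinarith [mul_nonpos_iff.mpr (Or.inl ⟨hm0, hα1⟩)]
  have hM : (15 * m) * (l - 1) ^ 2 + 2 * (((23 : ℤ) ^ 0 - 0 * (15 * l * m)) - (1 * (15 * l * m) - 1) - 1) * (l - 1) + 4 * (((23 : ℤ) ^ 0 - 0 * (15 * l * m)) - 1 - (15 * m)) ≤ 0 := by
    have hid : (15 * m) * (l - 1) ^ 2 + 2 * (((23 : ℤ) ^ 0 - 0 * (15 * l * m)) - (1 * (15 * l * m) - 1) - 1) * (l - 1) + 4 * (((23 : ℤ) ^ 0 - 0 * (15 * l * m)) - 1 - (15 * m)) =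
        m * ((-15) * l ^ 2 + (0) * l + (-45)) + ((0) * l ^ 2 + (2) * l + (-2)) := by ring
    rw [hid]; nlinarith [mul_nonpos_iff.mpr (Or.inl ⟨hm0, hαM⟩)]
  have hA : 0 ≤ (15 * m) := by positivity
  have h := InhBand.quad_nonpos_of_ends (15 * m) (((23 : ℤ) ^ 0 - 0 * (15 * l * m)) - (1 * (15 * l * m) - 1) - 1) (((23 : ℤ) ^ 0 - 0 * (15 * l * m)) - 1 - (15 * m)) (k + 1) l hA (by linarith) (by linarith) hkl h1 hM
  linarith [h]

/-- **Cells over `23` for `frey1`, EVERY level `l ≥ 5`, every `e = 15·l·m` (`m ≥ 1`), every label `j = k + 1 ≤ (l−1)/2`**: the socket's integer cell `e·⌊(j²P − j·D − (j+1)·ρin)/e⌋ + (j+1)·ρout ≤ P` with `P = e·2/(2l) = 15·m`, `D = e − 1`, `ρin = 1`, `ρout = min(23^0 − 0e, 23^1 − 1e)` (floor dropped, then `InhBand.poly_frey1_p23`). [folklore] -/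
theorem InhBand.cell_frey1_p23 {l m : ℕ} (hl : 5 ≤ l) (hm : 1 ≤ m) (k : ℕ) (hk : k < (l - 1) / 2) :
    ((15 * l * m : ℕ) : ℤ) *
          (((((k + 1 : ℕ) : ℤ) ^ 2 * ((15 * l * m * 2 / (2 * l) : ℕ) : ℤ) - ((k + 1 : ℕ) : ℤ) * ((15 * l * m - 1 : ℕ) : ℤ) -
              ((k + 2 : ℕ) : ℤ) * (1 : ℤ))) / ((15 * l * m : ℕ) : ℤ)) +
        ((k + 2 : ℕ) : ℤ) * min ((23 : ℤ) ^ 0 - 0 * ((15 * l * m : ℕ) : ℤ)) ((23 : ℤ) ^ 1 - 1 * ((15 * l * m : ℕ) : ℤ)) ≤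
      ((15 * l * m * 2 / (2 * l) : ℕ) : ℤ) := by
  have hP : (15 * l * m * 2 / (2 * l) : ℕ) = 15 * m := by
    rw [show 15 * l * m * 2 = 2 * l * (15 * m) by ring]; exact Nat.mul_div_cancel_left _ (by omega)
  have he0 : (0 : ℤ) < ((15 * l * m : ℕ) : ℤ) := by positivity
  have hfloor := Int.mul_ediv_self_le (k := ((15 * l * m : ℕ) : ℤ))
    (x := (((k + 1 : ℕ) : ℤ) ^ 2 * ((15 * l * m * 2 / (2 * l) : ℕ) : ℤ) - ((k + 1 : ℕ) : ℤ) * ((15 * l * m - 1 : ℕ) : ℤ) -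
              ((k + 2 : ℕ) : ℤ) * (1 : ℤ))) he0.ne'
  have hl0 : 0 < l := by omega
  have hm0 : 0 < m := by omega
  have hsub : ((15 * l * m - 1 : ℕ) : ℤ) = 1 * ((15 * l * m : ℕ) : ℤ) - 1 := by
    rw [Nat.cast_sub (Nat.succ_le_of_lt (by positivity))]; push_cast; ring
  have hmin : min ((23 : ℤ) ^ 0 - 0 * ((15 * l * m : ℕ) : ℤ)) ((23 : ℤ) ^ 1 - 1 * ((15 * l * m : ℕ) : ℤ)) ≤ (23 : ℤ) ^ 0 - 0 * ((15 * l * m : ℕ) : ℤ) := min_le_left _ _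
  have hk2 : (0 : ℤ) ≤ ((k + 2 : ℕ) : ℤ) := by positivity
  have hmin' := mul_le_mul_of_nonneg_left hmin hk2
  have hkl : 2 * ((k : ℤ) + 1) + 1 ≤ (l : ℤ) := by
    have h1 : 2 * (k + 1) + 1 ≤ l := by omega
    exact_mod_cast h1
  have hpoly := InhBand.poly_frey1_p23 (k : ℤ) (l : ℤ) (m : ℤ) (by exact_mod_cast hl) (by exact_mod_cast hm) (by positivity) hkl
  generalize hQ : ((((k + 1 : ℕ) : ℤ) ^ 2 * ((15 * l * m * 2 / (2 * l) : ℕ) : ℤ) - ((k + 1 : ℕ) : ℤ) * ((15 * l * m - 1 : ℕ) : ℤ) -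
              ((k + 2 : ℕ) : ℤ) * (1 : ℤ))) / ((15 * l * m : ℕ) : ℤ) = Q at hfloor ⊢
  rw [hP, hsub] at hfloor; rw [hP]
  push_cast at hfloor hmin' hpoly ⊢
  linarith [hfloor, hmin', hpoly]

/-! ## Over `53` (`v_53(abc) = 3`, `E₀ = 5`, `L₀ = 16`) -/

/-- Floor-free form of the cell over `53` for `frey1` (`e = 5·l·m`, `P = 15·m`, `D = e − 1`, `ρin = 1`, `ρout ≤ 53^1 − 1·e`): nonpositive at every label `1 ≤ k+1 ≤ (l−1)/2` for every `l ≥ 16`, `m ≥ 1` — convex in the label, both ends polynomial in `l` and linear in `m`. [folklore] -/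
theorem InhBand.poly_frey1_p53 (k l m : ℤ) (hl : 16 ≤ l) (hm : 1 ≤ m) (hk : 0 ≤ k) (hkl : 2 * (k + 1) + 1 ≤ l) :
    (k + 1) ^ 2 * (15 * m) - (k + 1) * (1 * (5 * l * m) - 1) - (k + 2) * 1 + (k + 2) * ((53 : ℤ) ^ 1 - 1 * (5 * l * m)) ≤ (15 * m) := by
  have hα1 : (-15) * l + (0) ≤ 0 := by linarith
  have hs1 : (-15) * l + (105) ≤ 0 := by linarith
  have hαM : (-5) * l ^ 2 + (-30) * l + (-45) ≤ 0 :=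
    InhBand.quad_nonpos_from (-5) (-30) (-45) 16 l hl (by norm_num) (by norm_num) (by norm_num)
  have hsM : (-5) * l ^ 2 + (76) * l + (57) ≤ 0 :=
    InhBand.quad_nonpos_from (-5) (76) (57) 16 l hl (by norm_num) (by norm_num) (by norm_num)
  have hm0 : 0 ≤ m - 1 := by linarith
  have h1 : (15 * m) + (((53 : ℤ) ^ 1 - 1 * (5 * l * m)) - (1 * (5 * l * m) - 1) - 1) + (((53 : ℤ) ^ 1 - 1 * (5 * l * m)) - 1 - (15 * m)) ≤ 0 := by
    have hid : (15 * m) + (((53 : ℤ) ^ 1 - 1 * (5 * l * m)) - (1 * (5 * l * m) - 1) - 1) + (((53 : ℤ) ^ 1 - 1 * (5 * l * m)) - 1 - (15 * m)) = m * ((-15) * l + (0)) + ((0) * l + (105)) := by ring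
    rw [hid]; nlinarith [mul_nonpos_iff.mpr (Or.inl ⟨hm0, hα1⟩)]
  have hM : (15 * m) * (l - 1) ^ 2 + 2 * (((53 : ℤ) ^ 1 - 1 * (5 * l * m)) - (1 * (5 * l * m) - 1) - 1) * (l - 1) + 4 * (((53 : ℤ) ^ 1 - 1 * (5 * l * m)) - 1 - (15 * m)) ≤ 0 := by
    have hid : (15 * m) * (l - 1) ^ 2 + 2 * (((53 : ℤ) ^ 1 - 1 * (5 * l * m)) - (1 * (5 * l * m) - 1) - 1) * (l - 1) + 4 * (((53 : ℤ) ^ 1 - 1 * (5 * l * m)) - 1 - (15 * m)) =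
        m * ((-5) * l ^ 2 + (-30) * l + (-45)) + ((0) * l ^ 2 + (106) * l + (102)) := by ring
    rw [hid]; nlinarith [mul_nonpos_iff.mpr (Or.inl ⟨hm0, hαM⟩)]
  have hA : 0 ≤ (15 * m) := by positivity
  have h := InhBand.quad_nonpos_of_ends (15 * m) (((53 : ℤ) ^ 1 - 1 * (5 * l * m)) - (1 * (5 * l * m) - 1) - 1) (((53 : ℤ) ^ 1 - 1 * (5 * l * m)) - 1 - (15 * m)) (k + 1) l hA (by linarith) (by linarith) hkl h1 hM
  linarith [h]

/-- **Cells over `53` for `frey1`, EVERY level `l ≥ 16`, every `e = 5·l·m` (`m ≥ 1`), every label `j = k + 1 ≤ (l−1)/2`**: the socket's integer cell `e·⌊(j²P − j·D − (j+1)·ρin)/e⌋ + (j+1)·ρout ≤ P` with `P = e·6/(2l) = 15·m`, `D = e − 1`, `ρin = 1`, `ρout = min(53^1 − 1e, 53^2 − 2e)` (floor dropped, then `InhBand.poly_frey1_p53`). [folklore] -/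
theorem InhBand.cell_frey1_p53 {l m : ℕ} (hl : 16 ≤ l) (hm : 1 ≤ m) (k : ℕ) (hk : k < (l - 1) / 2) :
    ((5 * l * m : ℕ) : ℤ) *
          (((((k + 1 : ℕ) : ℤ) ^ 2 * ((5 * l * m * 6 / (2 * l) : ℕ) : ℤ) - ((k + 1 : ℕ) : ℤ) * ((5 * l * m - 1 : ℕ) : ℤ) -
              ((k + 2 : ℕ) : ℤ) * (1 : ℤ))) / ((5 * l * m : ℕ) : ℤ)) +
        ((k + 2 : ℕ) : ℤ) * min ((53 : ℤ) ^ 1 - 1 * ((5 * l * m : ℕ) : ℤ)) ((53 : ℤ) ^ 2 - 2 * ((5 * l * m : ℕ) : ℤ)) ≤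
      ((5 * l * m * 6 / (2 * l) : ℕ) : ℤ) := by
  have hP : (5 * l * m * 6 / (2 * l) : ℕ) = 15 * m := by
    rw [show 5 * l * m * 6 = 2 * l * (15 * m) by ring]; exact Nat.mul_div_cancel_left _ (by omega)
  have he0 : (0 : ℤ) < ((5 * l * m : ℕ) : ℤ) := by positivity
  have hfloor := Int.mul_ediv_self_le (k := ((5 * l * m : ℕ) : ℤ))
    (x := (((k + 1 : ℕ) : ℤ) ^ 2 * ((5 * l * m * 6 / (2 * l) : ℕ) : ℤ) - ((k + 1 : ℕ) : ℤ) * ((5 * l * m - 1 : ℕ) : ℤ) -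
              ((k + 2 : ℕ) : ℤ) * (1 : ℤ))) he0.ne'
  have hl0 : 0 < l := by omega
  have hm0 : 0 < m := by omega
  have hsub : ((5 * l * m - 1 : ℕ) : ℤ) = 1 * ((5 * l * m : ℕ) : ℤ) - 1 := by
    rw [Nat.cast_sub (Nat.succ_le_of_lt (by positivity))]; push_cast; ring
  have hmin : min ((53 : ℤ) ^ 1 - 1 * ((5 * l * m : ℕ) : ℤ)) ((53 : ℤ) ^ 2 - 2 * ((5 * l * m : ℕ) : ℤ)) ≤ (53 : ℤ) ^ 1 - 1 * ((5 * l * m : ℕ) : ℤ) := min_le_left _ _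
  have hk2 : (0 : ℤ) ≤ ((k + 2 : ℕ) : ℤ) := by positivity
  have hmin' := mul_le_mul_of_nonneg_left hmin hk2
  have hkl : 2 * ((k : ℤ) + 1) + 1 ≤ (l : ℤ) := by
    have h1 : 2 * (k + 1) + 1 ≤ l := by omega
    exact_mod_cast h1
  have hpoly := InhBand.poly_frey1_p53 (k : ℤ) (l : ℤ) (m : ℤ) (by exact_mod_cast hl) (by exact_mod_cast hm) (by positivity) hkl
  generalize hQ : ((((k + 1 : ℕ) : ℤ) ^ 2 * ((5 * l * m * 6 / (2 * l) : ℕ) : ℤ) - ((k + 1 : ℕ) : ℤ) * ((5 * l * m - 1 : ℕ) : ℤ) -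
              ((k + 2 : ℕ) : ℤ) * (1 : ℤ))) / ((5 * l * m : ℕ) : ℤ) = Q at hfloor ⊢
  rw [hP, hsub] at hfloor; rw [hP]
  push_cast at hfloor hmin' hpoly ⊢
  linarith [hfloor, hmin', hpoly]

end Summit.ABC.IUTFork.Conditional
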